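import Literature.InformationTheory.QuantumCodes.StabilizerDistance
import Literature.InformationTheory.QuantumCodes.CSS
import HarnessLib

/-!
# Kovalev–Pryadko 2013, Theorem 1: every `[[N,K,D]]` stabilizer code `(A|B)` gives the two-sublattice
# CSS code `G_X = (A,B)`, `G_Z = (B,A)` with parameters `[[2N, 2K, D']]`, `D ≤ D' ≤ 2D`

A. A. Kovalev, L. P. Pryadko, *Quantum Kronecker sum-product low-density parity-check codes with finite
rate*, Phys. Rev. A 88 (2013) 012311 = arXiv:1212.6703 [KovalevPryadko2013Hyperbicycle], §III.A
"Two-sublattice CSS code from a generic stabilizer code" (held text chunk p0007 L21–47), read on the page: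

> **Theorem 1.** For any quantum stabilizer code `[[N,K,D]]` with the generator matrix `H = (A|B)`, there
> is a reversible mapping to a two-sublattice quantum CSS code (5) with `A₁ = A₂ᵀ = A`, `B₁ = B₂ᵀ = B` and
> the parameters `[[2N, 2K, D']]`, where `D ≤ D' ≤ 2D`.
> *Proof.* Explicitly, the generator matrices are `G_X = (A, B)`, `G_Z = (B, A)`. The dimension of the
> code simply follows from Eqs. (3), (4), given that `rank G_X = rank G_Z = rank H`. Any binary vector
> `e = (a|b)` such that `A b + B a = 0` maps to a pair of double-size vectors `e_z = (b, a)`, `e_x = (a, b)`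
> which satisfy `G_X e_z = 0`, `G_Z e_x = 0`; the corresponding weights obey the inequality
> `wgt_OR(a, b) ≤ wgt(a, b) ≤ 2 wgt_OR(a, b)`, which ensures the conditions on the distance. It is easy to
> check that the reverse mapping also works. □

This file PROVES Theorem 1 over the tree's vocabulary: the stabilizer code is the binary symplectic
subspace `stab A B = span {(A i | B i)} ≤ 𝔽₂^{2n}` (`SymplecticCodes.lean`: `SympVec`, `sympDual`,
`IsSelfOrthogonal`, `sympWeight` = `wgt_OR`; `StabilizerDistance.lean`: `minDistance`, `logicalDim`), and the
two-sublattice code is the `CSSCode` (`CSS.lean`) with check matrices `H_X = [A|B]`, `H_Z = [B|A]` on the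
qubit set `Fin n ⊕ Fin n`; the CSS commutation `H_X H_Zᵀ = A Bᵀ + B Aᵀ = 0` IS the symplectic
self-orthogonality of the rows (`isSelfOrthogonal_stab_iff`), which is the "reverse mapping" of the
theorem (any CSS pair of this shape comes from a stabilizer matrix `(A|B)`).

* `TwoSublattice.css A B h : CSSCode R R (Fin n ⊕ Fin n)` (`h : A * Bᵀ + B * Aᵀ = 0`);
* the dictionary: `HX_mulVec_sumElim_eq_zero_iff` (`G_X (u,w) = 0 ⟺ (w|u) ∈ S⊥`),
  `HZ_mulVec_sumElim_eq_zero_iff` (`G_Z (u,w) = 0 ⟺ (u|w) ∈ S⊥`), `sumElim_mem_rowSpZ_iff`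
  (`(u,w) ∈ rs G_Z ⟺ (w|u) ∈ S`), `sumElim_mem_rowSpX_iff` (`(u,w) ∈ rs G_X ⟺ (u|w) ∈ S`);
* the weights: `sympWeight_le_hammingNorm_add`, `hammingNorm_add_le_two_mul_sympWeight`
  (`wgt_OR(a,b) ≤ wgt(a) + wgt(b) ≤ 2 wgt_OR(a,b)`);
* **`css_k_eq` : `k(G_X, G_Z) = 2 · logicalDim (stab A B)`** (`= 2K`; `rank G_X = rank G_Z = rank H`);
* **`minDistance_le_css_dZ`, `css_dZ_le_two_mul_minDistance`, `minDistance_le_css_dX`,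
  `css_dX_le_two_mul_minDistance`** : `D ≤ d_Z ≤ 2D`, `D ≤ d_X ≤ 2D` with `D = minDistance (stab A B)` the
  stabilizer code's distance (junk values agree: no logical ⟺ `D = d_X = d_Z = 0`);
* `KovalevPryadko2013_theorem1` — the printed sentence for an `[[n, K, D]]` additive code `stab A B`
  (`IsAdditiveCode`, `K > 0`): `k = 2K`, `D ≤ d_X, d_Z ≤ 2·minDistance`.

No named facts, no instances. (The sparsity remark "row weight at most doubled" is
`hammingNorm_add_le_two_mul_sympWeight` applied to the rows.)

## References (locators read on the page)
* [KovalevPryadko2013Hyperbicycle] arXiv:1212.6703, §III.A Thm 1 and proof (chunk p0007 L21–47); eq. (5)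
  two-sublattice ansatz (chunk p0007 L1–19).
* [CalderbankEtAl1998] Calderbank–Rains–Shor–Sloane, IEEE Trans. IT 44 (1998) 1369, §2 Thm 1 (binary
  symplectic representation `(a|b)`, weight, `[[n,k,d]]`).
-/

namespace Literature.InformationTheory.QuantumCodes

open Matrix

namespace TwoSublattice

variable {n : ℕ} {R : Type*} [Fintype R]

/-! ### The stabilizer space of `(A|B)` and the two-sublattice CSS code -/

/-- The stabilizer space `S = rowspace (A|B) ≤ 𝔽₂^{2n}` of the generator matrix `H = (A|B)` (binary
symplectic form, rows `(A i | B i)`). [cite: KovalevPryadko2013Hyperbicycle, Thm 1 (arXiv:1212.6703 chunk p0007 L26-31: "generator matrix H = (A|B)")] [cite: CalderbankEtAl1998, §2 (binary (a|b) representation)] -/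
def stab (A B : Matrix R (Fin n) (ZMod 2)) : Submodule (ZMod 2) (SympVec n) :=
  Submodule.span (ZMod 2) (Set.range fun i => ((A i, B i) : SympVec n))

omit [Fintype R] in
/-- `[A|B] [B|A]ᵀ = A Bᵀ + B Aᵀ`. [cite: KovalevPryadko2013Hyperbicycle, eq. (5) and Thm 1 (arXiv:1212.6703 chunk p0007 L17-19, L33-35)] -/
theorem fromCols_mul_fromCols_transpose (A B : Matrix R (Fin n) (ZMod 2)) :
    fromCols A B * (fromCols B A)ᵀ = A * Bᵀ + B * Aᵀ := by
  rw [transpose_fromCols, fromCols_mul_fromRows]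

omit [Fintype R] in
/-- The CSS commutation `A Bᵀ + B Aᵀ = 0` of `G_X = (A,B)`, `G_Z = (B,A)` IS the symplectic
self-orthogonality of the stabilizer rows `(A|B)` (the "reversible mapping").
[cite: KovalevPryadko2013Hyperbicycle, Thm 1 and proof (arXiv:1212.6703 chunk p0007 L26-47: "the reverse mapping also works")] -/
theorem isSelfOrthogonal_stab_iff (A B : Matrix R (Fin n) (ZMod 2)) :
    IsSelfOrthogonal (stab A B) ↔ A * Bᵀ + B * Aᵀ = 0 := by
  rw [stab, isSelfOrthogonal_span_range_iff]
  have key : ∀ i j, sympInner ((A i, B i) : SympVec n) ((A j, B j) : SympVec n) = (A * Bᵀ + B * Aᵀ) i j := by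
    intro i j
    simp only [sympInner, Matrix.add_apply, Matrix.mul_apply, Matrix.transpose_apply, dotProduct]
    congr 1
    exact Finset.sum_congr rfl fun l _ => mul_comm _ _
  simp_rw [key]
  exact ⟨fun h => Matrix.ext fun i j => h i j, fun h i j => by rw [h, Matrix.zero_apply]⟩

/-- **The two-sublattice CSS code of a stabilizer matrix `(A|B)`**: `G_X = (A, B)`, `G_Z = (B, A)` on
`2n` qubits (`Fin n ⊕ Fin n`), for rows satisfying `A Bᵀ + B Aᵀ = 0`.
[cite: KovalevPryadko2013Hyperbicycle, Thm 1 proof (arXiv:1212.6703 chunk p0007 L33-35: "G_X = (A,B), G_Z = (B,A)")] -/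
def css (A B : Matrix R (Fin n) (ZMod 2)) (h : A * Bᵀ + B * Aᵀ = 0) : CSSCode R R (Fin n ⊕ Fin n) :=
  ⟨fromCols A B, fromCols B A, by rw [fromCols_mul_fromCols_transpose, h]⟩

omit [Fintype R] in
/-- `(css A B h).HX = [A|B]`. [cite: KovalevPryadko2013Hyperbicycle, Thm 1 proof (arXiv:1212.6703 chunk p0007 L33-35)] -/
@[simp] theorem css_HX (A B : Matrix R (Fin n) (ZMod 2)) (h : A * Bᵀ + B * Aᵀ = 0) :
    (css A B h).HX = fromCols A B := rfl

omit [Fintype R] in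
/-- `(css A B h).HZ = [B|A]`. [cite: KovalevPryadko2013Hyperbicycle, Thm 1 proof (arXiv:1212.6703 chunk p0007 L33-35)] -/
@[simp] theorem css_HZ (A B : Matrix R (Fin n) (ZMod 2)) (h : A * Bᵀ + B * Aᵀ = 0) :
    (css A B h).HZ = fromCols B A := rfl

/-- `2N` qubits. [cite: KovalevPryadko2013Hyperbicycle, Thm 1 (arXiv:1212.6703 chunk p0007 L29-31: "[[2N, 2K, D']]")] -/
theorem card_qubits : Fintype.card (Fin n ⊕ Fin n) = 2 * n := by
  rw [Fintype.card_sum, Fintype.card_fin]; ring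

/-! ### The dictionary between CSS logicals and stabilizer-code logicals -/

/-- Membership in the span of the rows: `x ∈ S ⟺ x = (y (A), y (B))` for a row vector `y`.
[cite: CalderbankEtAl1998, §2 (binary (a|b) representation)] -/
theorem mem_stab_iff (A B : Matrix R (Fin n) (ZMod 2)) (x : SympVec n) :
    x ∈ stab A B ↔ ∃ y : R → ZMod 2, (y ᵥ* A, y ᵥ* B) = x := by
  rw [stab, Submodule.mem_span_range_iff_exists_fun]
  refine exists_congr fun y => ?_
  have h1 : ∑ i, y i • ((A i, B i) : SympVec n) = (y ᵥ* A, y ᵥ* B) := by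
    ext j
    · simp [vecMul, dotProduct, Finset.sum_apply, Prod.fst_sum, mul_comm]
    · simp [vecMul, dotProduct, Finset.sum_apply, Prod.snd_sum, mul_comm]
  rw [h1]

omit [Fintype R] in
/-- Membership in the symplectic dual of the row span: `x ∈ S⊥ ⟺ A x.2 + B x.1 = 0`
(i.e. `sympInner (A i | B i) x = 0` for every row). [cite: KovalevPryadko2013Hyperbicycle, Thm 1 proof (arXiv:1212.6703 chunk p0007 L36-37: "e = (a|b) such that A b + B a = 0")] -/
theorem mem_sympDual_stab_iff (A B : Matrix R (Fin n) (ZMod 2)) (x : SympVec n) :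
    x ∈ sympDual (stab A B) ↔ A *ᵥ x.2 + B *ᵥ x.1 = 0 := by
  rw [stab, mem_sympDual_span_range_iff]
  refine ⟨fun h => funext fun i => ?_, fun h i => ?_⟩
  · have := h i
    simp only [sympInner] at this
    simp only [Pi.add_apply, mulVec, Pi.zero_apply]
    rw [← this, dotProduct_comm x.1]
  · have := congrFun h i
    simp only [Pi.add_apply, mulVec, Pi.zero_apply] at this
    simp only [sympInner]
    rw [← this, dotProduct_comm (B i)]

omit [Fintype R] in
/-- `G_X (u, w) = 0 ⟺ (w|u) ∈ S⊥` ("`e_z = (b, a)` satisfies `G_X e_z = 0`" for `e = (a|b)`, `A b + B a = 0`).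
[cite: KovalevPryadko2013Hyperbicycle, Thm 1 proof (arXiv:1212.6703 chunk p0007 L36-40)] -/
theorem HX_mulVec_sumElim_eq_zero_iff (A B : Matrix R (Fin n) (ZMod 2)) (h : A * Bᵀ + B * Aᵀ = 0)
    (u w : Fin n → ZMod 2) :
    (css A B h).HX *ᵥ Sum.elim u w = 0 ↔ ((w, u) : SympVec n) ∈ sympDual (stab A B) := by
  rw [mem_sympDual_stab_iff, css_HX, fromCols_mulVec_sumElim]

omit [Fintype R] in
/-- `G_Z (u, w) = 0 ⟺ (u|w) ∈ S⊥` ("`e_x = (a, b)` satisfies `G_Z e_x = 0`").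
[cite: KovalevPryadko2013Hyperbicycle, Thm 1 proof (arXiv:1212.6703 chunk p0007 L36-40)] -/
theorem HZ_mulVec_sumElim_eq_zero_iff (A B : Matrix R (Fin n) (ZMod 2)) (h : A * Bᵀ + B * Aᵀ = 0)
    (u w : Fin n → ZMod 2) :
    (css A B h).HZ *ᵥ Sum.elim u w = 0 ↔ ((u, w) : SympVec n) ∈ sympDual (stab A B) := by
  rw [mem_sympDual_stab_iff, css_HZ, fromCols_mulVec_sumElim, add_comm]

/-- `(u, w) ∈ rs G_Z ⟺ (w|u) ∈ S`. [cite: KovalevPryadko2013Hyperbicycle, Thm 1 proof (arXiv:1212.6703 chunk p0007 L33-40)] -/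
theorem sumElim_mem_rowSpZ_iff (A B : Matrix R (Fin n) (ZMod 2)) (h : A * Bᵀ + B * Aᵀ = 0)
    (u w : Fin n → ZMod 2) :
    Sum.elim u w ∈ (css A B h).rowSpZ ↔ ((w, u) : SympVec n) ∈ stab A B := by
  rw [CSSCode.rowSpZ, mem_rowSpace_iff, mem_stab_iff, css_HZ]
  refine exists_congr fun y => ?_
  rw [vecMul_fromCols, Prod.mk.injEq]
  constructor
  · intro hy
    exact ⟨by simpa using congrArg (fun v => v ∘ Sum.inr) hy, by simpa using congrArg (fun v => v ∘ Sum.inl) hy⟩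
  · rintro ⟨h1, h2⟩
    rw [h1, h2]

/-- `(u, w) ∈ rs G_X ⟺ (u|w) ∈ S`. [cite: KovalevPryadko2013Hyperbicycle, Thm 1 proof (arXiv:1212.6703 chunk p0007 L33-40)] -/
theorem sumElim_mem_rowSpX_iff (A B : Matrix R (Fin n) (ZMod 2)) (h : A * Bᵀ + B * Aᵀ = 0)
    (u w : Fin n → ZMod 2) :
    Sum.elim u w ∈ (css A B h).rowSpX ↔ ((u, w) : SympVec n) ∈ stab A B := by
  rw [CSSCode.rowSpX, mem_rowSpace_iff, mem_stab_iff, css_HX]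
  refine exists_congr fun y => ?_
  rw [vecMul_fromCols, Prod.mk.injEq]
  constructor
  · intro hy
    exact ⟨by simpa using congrArg (fun v => v ∘ Sum.inl) hy, by simpa using congrArg (fun v => v ∘ Sum.inr) hy⟩
  · rintro ⟨h1, h2⟩
    rw [h1, h2]

/-! ### `wgt_OR(a,b) ≤ wgt(a,b) ≤ 2 wgt_OR(a,b)` -/

/-- `|(u, w)| = |u| + |w|` on `Fin n ⊕ Fin n`. [cite: KovalevPryadko2013Hyperbicycle, Thm 1 proof (arXiv:1212.6703 chunk p0007 L40-42: "wgt(a,b)")] -/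
theorem hammingNorm_sumElim (u w : Fin n → ZMod 2) : hammingNorm (Sum.elim u w) = hammingNorm u + hammingNorm w := by
  unfold hammingNorm
  rw [← Finset.card_disjSum]
  congr 1
  ext i
  rcases i with i | i <;> simp [Finset.mem_disjSum]

/-- `wgt_OR(a,b) ≤ wgt(a) + wgt(b)`. [cite: KovalevPryadko2013Hyperbicycle, Thm 1 proof (arXiv:1212.6703 chunk p0007 L40-42)] -/
theorem sympWeight_le_hammingNorm_add (x : SympVec n) : sympWeight x ≤ hammingNorm x.1 + hammingNorm x.2 := by
  unfold sympWeight hammingNorm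
  rw [Finset.filter_or]
  exact Finset.card_union_le _ _

/-- `wgt(a) + wgt(b) ≤ 2 wgt_OR(a,b)`. [cite: KovalevPryadko2013Hyperbicycle, Thm 1 proof (arXiv:1212.6703 chunk p0007 L40-42)] -/
theorem hammingNorm_add_le_two_mul_sympWeight (x : SympVec n) :
    hammingNorm x.1 + hammingNorm x.2 ≤ 2 * sympWeight x := by
  have h1 := hammingNorm_fst_le_sympWeight x
  have h2 := hammingNorm_snd_le_sympWeight x
  omega

/-- `wgt_OR` is symmetric in the two halves. [cite: CalderbankEtAl1998, §2 (weight of (a|b))] -/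
theorem sympWeight_swap (u w : Fin n → ZMod 2) : sympWeight ((w, u) : SympVec n) = sympWeight ((u, w) : SympVec n) := by
  unfold sympWeight
  congr 1
  ext i
  simp only [Finset.mem_filter, Finset.mem_univ, true_and]
  exact or_comm

/-! ### Dimension: `k = 2K` -/

/-- `rank [A|B] = dim S` (`rank G_X = rank H`). [cite: KovalevPryadko2013Hyperbicycle, Thm 1 proof (arXiv:1212.6703 chunk p0007 L35-36: "rank G_X = rank G_Z = rank H")] -/
theorem rank_fromCols_eq_finrank_stab (A B : Matrix R (Fin n) (ZMod 2)) :
    (fromCols A B).rank = Module.finrank (ZMod 2) (stab A B) := by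
  rw [← finrank_rowSpace_eq_rank]
  -- the linear isomorphism `(Fin n ⊕ Fin n → 𝔽₂) ≃ 𝔽₂ⁿ × 𝔽₂ⁿ` carries `rs [A|B]` onto `S`
  let e : (Fin n ⊕ Fin n → ZMod 2) ≃ₗ[ZMod 2] SympVec n := LinearEquiv.sumArrowLequivProdArrow _ _ (ZMod 2) (ZMod 2)
  have hmap : (rowSpace (fromCols A B)).map (e : (Fin n ⊕ Fin n → ZMod 2) →ₗ[ZMod 2] SympVec n) = stab A B := by
    ext x
    simp only [Submodule.mem_map, mem_rowSpace_iff, mem_stab_iff]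
    constructor
    · rintro ⟨v, ⟨y, rfl⟩, rfl⟩
      refine ⟨y, ?_⟩
      ext j
      · simp [e, LinearEquiv.sumArrowLequivProdArrow, vecMul_fromCols]
      · simp [e, LinearEquiv.sumArrowLequivProdArrow, vecMul_fromCols]
    · rintro ⟨y, rfl⟩
      refine ⟨y ᵥ* fromCols A B, ⟨y, rfl⟩, ?_⟩
      ext j
      · simp [e, LinearEquiv.sumArrowLequivProdArrow, vecMul_fromCols]
      · simp [e, LinearEquiv.sumArrowLequivProdArrow, vecMul_fromCols]
  rw [← hmap, LinearEquiv.finrank_map_eq]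

omit [Fintype R] in
/-- `rank [B|A] = rank [A|B]` (`rank G_Z = rank G_X`). [cite: KovalevPryadko2013Hyperbicycle, Thm 1 proof (arXiv:1212.6703 chunk p0007 L35-36)] -/
theorem rank_fromCols_swap (A B : Matrix R (Fin n) (ZMod 2)) : (fromCols B A).rank = (fromCols A B).rank := by
  have : fromCols B A = reindex (Equiv.refl R) (Equiv.sumComm (Fin n) (Fin n)) (fromCols A B) := by
    ext i j; rcases j with j | j <;> rfl
  rw [this, rank_reindex]

/-- **`k(G_X, G_Z) = 2K`**, `K = logicalDim S = n − dim S` the number of logical qubits of the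
stabilizer code `(A|B)`. [cite: KovalevPryadko2013Hyperbicycle, Thm 1 (arXiv:1212.6703 chunk p0007 L29-36: "[[2N, 2K, D']] … The dimension of the code simply follows … given that rank G_X = rank G_Z = rank H")] -/
theorem css_k_eq (A B : Matrix R (Fin n) (ZMod 2)) (h : A * Bᵀ + B * Aᵀ = 0) :
    (css A B h).k = 2 * logicalDim (stab A B) := by
  have hS : IsSelfOrthogonal (stab A B) := (isSelfOrthogonal_stab_iff A B).2 h
  have hle := hS.finrank_le
  rw [CSSCode.k_eq, css_HX, css_HZ, rank_fromCols_swap A B, rank_fromCols_eq_finrank_stab A B, card_qubits, logicalDim]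
  omega

/-! ### Distances: `D ≤ D' ≤ 2D` -/

/-- Every binary vector on `Fin n ⊕ Fin n` is a pair. [folklore] -/
private theorem sumElim_comp_inl_inr (v : Fin n ⊕ Fin n → ZMod 2) : Sum.elim (v ∘ Sum.inl) (v ∘ Sum.inr) = v :=
  Sum.elim_comp_inl_inr v

/-- **`D ≤ d_Z`**: every `Z`-logical `(u,w)` of `(G_X, G_Z)` is `(b,a)` for a logical `(a|b) ∈ S⊥ ∖ S` of the
stabilizer code, and `wgt_OR(a,b) ≤ wgt(a) + wgt(b)`. [cite: KovalevPryadko2013Hyperbicycle, Thm 1 (arXiv:1212.6703 chunk p0007 L36-44: "D ≤ D'")] -/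
theorem minDistance_le_css_dZ (A B : Matrix R (Fin n) (ZMod 2)) (h : A * Bᵀ + B * Aᵀ = 0) :
    minDistance (stab A B) ≤ (css A B h).dZ := by
  by_cases hex : ∃ v : Fin n ⊕ Fin n → ZMod 2, (css A B h).HX *ᵥ v = 0 ∧ v ∉ (css A B h).rowSpZ
  · refine (css A B h).le_dZ hex fun v hv hv' => ?_
    rw [← sumElim_comp_inl_inr v] at hv hv' ⊢
    rw [HX_mulVec_sumElim_eq_zero_iff] at hv
    rw [sumElim_mem_rowSpZ_iff] at hv'
    calc minDistance (stab A B) ≤ sympWeight ((v ∘ Sum.inr, v ∘ Sum.inl) : SympVec n) :=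
          minDistance_le_sympWeight hv hv'
      _ ≤ hammingNorm (v ∘ Sum.inr) + hammingNorm (v ∘ Sum.inl) := sympWeight_le_hammingNorm_add _
      _ = hammingNorm (Sum.elim (v ∘ Sum.inl) (v ∘ Sum.inr)) := by rw [hammingNorm_sumElim, add_comm]
  · -- no `Z`-logical: then `S⊥ ⊆ S` and both distances are the junk value `0`
    have h0 : minDistance (stab A B) = 0 := by
      rw [minDistance_eq_zero_iff]
      intro x hx
      by_contra hx'
      exact hex ⟨Sum.elim x.2 x.1, (HX_mulVec_sumElim_eq_zero_iff A B h _ _).2 hx,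
        fun hm => hx' ((sumElim_mem_rowSpZ_iff A B h _ _).1 hm)⟩
    rw [h0]; exact Nat.zero_le _

/-- **`d_Z ≤ 2D`**: a minimum-weight logical `(a|b)` of the stabilizer code gives the `Z`-logical `(b,a)` of
weight `wgt(a) + wgt(b) ≤ 2 wgt_OR(a,b)`. [cite: KovalevPryadko2013Hyperbicycle, Thm 1 (arXiv:1212.6703 chunk p0007 L36-44: "D' ≤ 2D")] -/
theorem css_dZ_le_two_mul_minDistance (A B : Matrix R (Fin n) (ZMod 2)) (h : A * Bᵀ + B * Aᵀ = 0) :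
    (css A B h).dZ ≤ 2 * minDistance (stab A B) := by
  by_cases hex : ∃ x ∈ sympDual (stab A B), x ∉ stab A B
  · obtain ⟨x, hx, hx', hxd⟩ := exists_sympWeight_eq_minDistance hex
    calc (css A B h).dZ ≤ hammingNorm (Sum.elim x.2 x.1) :=
          (css A B h).dZ_le_hammingNorm ((HX_mulVec_sumElim_eq_zero_iff A B h _ _).2 hx)
            (fun hm => hx' ((sumElim_mem_rowSpZ_iff A B h _ _).1 hm))
      _ = hammingNorm x.1 + hammingNorm x.2 := by rw [hammingNorm_sumElim, add_comm]
      _ ≤ 2 * sympWeight x := hammingNorm_add_le_two_mul_sympWeight x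
      _ = 2 * minDistance (stab A B) := by rw [hxd]
  · -- no logical: `d_Z = 0`
    have h0 : (css A B h).dZ = 0 := by
      rw [CSSCode.dZ, CSSCode.dX_eq_zero_iff]
      refine le_antisymm (fun v hv => ?_) (css A B h).swap.rowSpX_le_kerZ
      rw [← sumElim_comp_inl_inr v] at hv ⊢
      change (css A B h).HX *ᵥ _ = 0 at hv
      rw [HX_mulVec_sumElim_eq_zero_iff] at hv
      change _ ∈ (css A B h).rowSpZ
      rw [sumElim_mem_rowSpZ_iff]
      by_contra hm
      exact hex ⟨_, hv, hm⟩
    rw [h0]; exact Nat.zero_le _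

/-- **`D ≤ d_X`** (the `X`-logicals `(u,w)` are the logicals `(a|b) = (u|w)` themselves).
[cite: KovalevPryadko2013Hyperbicycle, Thm 1 (arXiv:1212.6703 chunk p0007 L36-44)] -/
theorem minDistance_le_css_dX (A B : Matrix R (Fin n) (ZMod 2)) (h : A * Bᵀ + B * Aᵀ = 0) :
    minDistance (stab A B) ≤ (css A B h).dX := by
  by_cases hex : ∃ v : Fin n ⊕ Fin n → ZMod 2, (css A B h).HZ *ᵥ v = 0 ∧ v ∉ (css A B h).rowSpX
  · refine (css A B h).le_dX hex fun v hv hv' => ?_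
    rw [← sumElim_comp_inl_inr v] at hv hv' ⊢
    rw [HZ_mulVec_sumElim_eq_zero_iff] at hv
    rw [sumElim_mem_rowSpX_iff] at hv'
    calc minDistance (stab A B) ≤ sympWeight ((v ∘ Sum.inl, v ∘ Sum.inr) : SympVec n) :=
          minDistance_le_sympWeight hv hv'
      _ ≤ hammingNorm (v ∘ Sum.inl) + hammingNorm (v ∘ Sum.inr) := sympWeight_le_hammingNorm_add _
      _ = hammingNorm (Sum.elim (v ∘ Sum.inl) (v ∘ Sum.inr)) := by rw [hammingNorm_sumElim]
  · have h0 : minDistance (stab A B) = 0 := by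
      rw [minDistance_eq_zero_iff]
      intro x hx
      by_contra hx'
      exact hex ⟨Sum.elim x.1 x.2, (HZ_mulVec_sumElim_eq_zero_iff A B h _ _).2 hx,
        fun hm => hx' ((sumElim_mem_rowSpX_iff A B h _ _).1 hm)⟩
    rw [h0]; exact Nat.zero_le _

/-- **`d_X ≤ 2D`**. [cite: KovalevPryadko2013Hyperbicycle, Thm 1 (arXiv:1212.6703 chunk p0007 L36-44)] -/
theorem css_dX_le_two_mul_minDistance (A B : Matrix R (Fin n) (ZMod 2)) (h : A * Bᵀ + B * Aᵀ = 0) :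
    (css A B h).dX ≤ 2 * minDistance (stab A B) := by
  by_cases hex : ∃ x ∈ sympDual (stab A B), x ∉ stab A B
  · obtain ⟨x, hx, hx', hxd⟩ := exists_sympWeight_eq_minDistance hex
    calc (css A B h).dX ≤ hammingNorm (Sum.elim x.1 x.2) :=
          (css A B h).dX_le_hammingNorm ((HZ_mulVec_sumElim_eq_zero_iff A B h _ _).2 hx)
            (fun hm => hx' ((sumElim_mem_rowSpX_iff A B h _ _).1 hm))
      _ = hammingNorm x.1 + hammingNorm x.2 := hammingNorm_sumElim _ _
      _ ≤ 2 * sympWeight x := hammingNorm_add_le_two_mul_sympWeight x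
      _ = 2 * minDistance (stab A B) := by rw [hxd]
  · have h0 : (css A B h).dX = 0 := by
      rw [CSSCode.dX_eq_zero_iff]
      refine le_antisymm (fun v hv => ?_) (css A B h).rowSpX_le_kerZ
      rw [← sumElim_comp_inl_inr v] at hv ⊢
      change (css A B h).HZ *ᵥ _ = 0 at hv
      rw [HZ_mulVec_sumElim_eq_zero_iff] at hv
      rw [sumElim_mem_rowSpX_iff]
      by_contra hm
      exact hex ⟨_, hv, hm⟩
    rw [h0]; exact Nat.zero_le _

/-- **Kovalev–Pryadko 2013, Theorem 1** (the printed sentence). An `[[n, K, D]]` stabilizer (additive) code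
with generator matrix `(A|B)` — `S = stab A B` self-orthogonal of dimension `n − K` with all logicals of weight
`≥ D`, `K > 0` — yields the two-sublattice CSS code `G_X = (A,B)`, `G_Z = (B,A)` on `2n` qubits with
`k = 2K` and both distances `D'` satisfying `D ≤ D' ≤ 2·d(S)`, `d(S) = minDistance S ≥ D` the true distance.
[cite: KovalevPryadko2013Hyperbicycle, Thm 1 (arXiv:1212.6703 chunk p0007 L26-31: "there is a reversible mapping to a two-sublattice quantum CSS code … with … the parameters [[2N,2K,D']], where D ≤ D' ≤ 2D")] -/
theorem KovalevPryadko2013_theorem1 (A B : Matrix R (Fin n) (ZMod 2)) {K D : ℕ}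
    (hS : IsAdditiveCode (stab A B) K D) (hK : 0 < K) :
    ∃ h : A * Bᵀ + B * Aᵀ = 0,
      Fintype.card (Fin n ⊕ Fin n) = 2 * n ∧ (css A B h).k = 2 * K ∧
        D ≤ (css A B h).dZ ∧ (css A B h).dZ ≤ 2 * minDistance (stab A B) ∧
        D ≤ (css A B h).dX ∧ (css A B h).dX ≤ 2 * minDistance (stab A B) := by
  have h : A * Bᵀ + B * Aᵀ = 0 := (isSelfOrthogonal_stab_iff A B).1 hS.1
  have hex : ∃ w ∈ sympDual (stab A B), w ∉ stab A B := by
    rw [exists_logical_iff_logicalDim_pos hS.1, hS.logicalDim_eq]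
    exact hK
  have hD : D ≤ minDistance (stab A B) := le_minDistance hex hS.2.2.1
  exact ⟨h, card_qubits, by rw [css_k_eq, hS.logicalDim_eq], hD.trans (minDistance_le_css_dZ A B h),
    css_dZ_le_two_mul_minDistance A B h, hD.trans (minDistance_le_css_dX A B h),
    css_dX_le_two_mul_minDistance A B h⟩

end TwoSublattice

end Literature.InformationTheory.QuantumCodes
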